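import Mathlib
import HarnessLib
import Summits.KontsevichZagierPeriods.Zeta5Search.Denom.CatalanRayCoefAbs

/-!
# CatalanRayPClosedBound — the archimedean envelope `|PClosed n J| ≤ 48 (J+2n+1)³ · n · C(J+2n, n)` (fam-denom D9c, part 3)

HONEST FRAMING: systematic search; no irrationality claim unless certified.

fam-denom (pub-zeta5), `families/denom/PCLOSED-API.md` §T-G.  From the puncture factorizations of `CatalanRayCoefAbs`
and `(½)_n ≤ n!`:
* **`abs_coef_neg_le`**: `1 ≤ a ≤ 2n`, `n ≤ J` ⟹ `|coef n J (−a)| ≤ n · C(J+2n, n)` (families β, γ);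
* **`abs_coef_nat_le`**: `c + n ≤ J` ⟹ `|coef n J c| ≤ n · C(J+2n, n)` (family α);
* with `CatalanRayPClosedAbs.abs_PClosed_le_of_coef`: **`abs_PClosed_le`**: `1 ≤ n ≤ J` ⟹
  `|PClosed n J| ≤ 48 (J+2n+1)³ · (n · C(J+2n, n))`, and on the ray `J = jn` **`abs_rayPClosed_le`**:
  `|rayPClosed j n| ≤ 48 ((j+2)n+1)³ · (n · C((j+2)n, n))` (`j, n ≥ 1`).
So `|rayPClosed j n| ≤ poly(n) · e^{b_{j+1} n}` with `b_{j+1} = (j+2) log(j+2) − (j+1) log(j+1)` (tree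
`CatalanRayQBound.choose_ray_le_exp` at `j+1`).  This is the crude uniform envelope (the γ family `n < a ≤ 2n` carries
`(a+J)!/(a+J−n)!` with `a` up to `2n`); numerically `max_d |coef| ≈ 0.42 · C(J+n, n)` (PCLOSED-API.md).  For fam-catalan's
two-node criterion (T-G) the loss `b_{j+1} − b_j` (0.167 / 0.144 / 0.110 at `j = 5 / 6 / 8`) is inside the stated margins
(0.25 / 0.39 / 0.50).
-/

namespace Summit.KontsevichZagierPeriods.Zeta5Search.Denom.CatalanRayPClosed

open Finset
open Summit.KontsevichZagierPeriods.Zeta5Search.Denom.CatalanRayAtoms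

/-! ### The coefficient envelopes -/

/-- `|coef| · (|D₁|·|D₂|) = (½)_n · |N|`. -/
theorem abs_coef_mul (n J : ℕ) (d : ℚ) : |coef n J d| * (|D1 n J d| * |D2 n d|) = K0 n * |Nnum n J d| := by
  have h : coef n J d * (D1 n J d * D2 n d) = K0 n * Nnum n J d := by
    unfold coef; exact div_mul_cancel₀ _ (mul_ne_zero (D1_ne n J d) (D2_ne n d))
  have h' := congrArg abs h
  rw [abs_mul, abs_mul, abs_mul, abs_of_pos (K0_pos n)] at h'
  exact h'

/-- `C(J+2n, n) · n! · (J+n)! = (J+2n)!` in `ℚ`. -/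
theorem choose_mul_factorials (J n : ℕ) :
    (((J + 2 * n).choose n : ℕ) : ℚ) * (n.factorial : ℚ) * ((J + n).factorial : ℚ) = ((J + 2 * n).factorial : ℚ) := by
  have := Nat.choose_mul_factorial_mul_factorial (show n ≤ J + 2 * n by omega)
  rw [show J + 2 * n - n = J + n by omega] at this
  exact_mod_cast this

/-- **Poles `T = −a`** (families β and γ): `|coef n J (−a)| ≤ n · C(J+2n, n)` for `1 ≤ a ≤ 2n`, `n ≤ J`. -/
theorem abs_coef_neg_le (n J a : ℕ) (hn : 1 ≤ n) (ha1 : 1 ≤ a) (ha2 : a ≤ 2 * n) (hJ : n ≤ J) :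
    |coef n J (-(a : ℚ))| ≤ n * (((J + 2 * n).choose n : ℕ) : ℚ) := by
  set D : ℚ := (((a + J - n).factorial * ((a - 1).factorial * (2 * n - a).factorial) : ℕ) : ℚ) with hD
  have hDpos : 0 < D := by rw [hD]; positivity
  -- Step 1: `|coef| · D ≤ n! · (a+J)!`
  have hmain : |coef n J (-(a : ℚ))| * D ≤ (n.factorial : ℚ) * ((a + J).factorial : ℚ) := by
    have hcm := abs_coef_mul n J (-(a : ℚ))
    have hK := K0_le_factorial n
    have hK0 := (K0_pos n).le
    rw [abs_D2_neg n a ha1 ha2] at hcm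
    rcases le_or_gt a n with ha | ha
    · rw [abs_D1_beta n J a ha (by omega)] at hcm
      have hN := abs_Nnum_beta_le n J a ha
      have hpos : (0 : ℚ) < ((n - a).factorial : ℚ) := by positivity
      have h : |coef n J (-(a : ℚ))| * D * ((n - a).factorial : ℚ)
          ≤ (n.factorial : ℚ) * ((a + J).factorial : ℚ) * ((n - a).factorial : ℚ) := by
        calc |coef n J (-(a : ℚ))| * D * ((n - a).factorial : ℚ)
            = |coef n J (-(a : ℚ))| * ((((a + J - n).factorial * (n - a).factorial : ℕ) : ℚ)
                * ((((a - 1).factorial * (2 * n - a).factorial : ℕ)) : ℚ)) := by rw [hD]; push_cast; ring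
          _ = K0 n * |Nnum n J (-(a : ℚ))| := hcm
          _ ≤ (n.factorial : ℚ) * (((a + J).factorial : ℚ) * ((n - a).factorial : ℚ)) :=
              mul_le_mul hK hN (abs_nonneg _) (by positivity)
          _ = (n.factorial : ℚ) * ((a + J).factorial : ℚ) * ((n - a).factorial : ℚ) := by ring
      exact le_of_mul_le_mul_right h hpos
    · have hD1 := abs_D1_gamma n J a ha
      have hN := abs_Nnum_gamma_le n J a ha
      have hfac : (((a - n - 1).factorial : ℕ) : ℚ) ≤ (((a - n).factorial : ℕ) : ℚ) := by
        exact_mod_cast Nat.factorial_le (by omega)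
      have hD1nn : 0 ≤ |D1 n J (-(a : ℚ))| := abs_nonneg _
      have hNnn : 0 ≤ |Nnum n J (-(a : ℚ))| := abs_nonneg _
      calc |coef n J (-(a : ℚ))| * D
          = |coef n J (-(a : ℚ))| * ((|D1 n J (-(a : ℚ))| * ((a - n - 1).factorial : ℚ))
              * ((((a - 1).factorial * (2 * n - a).factorial : ℕ)) : ℚ)) := by rw [hD, hD1]; push_cast; ring
        _ = (|coef n J (-(a : ℚ))| * (|D1 n J (-(a : ℚ))| * |D2 n (-(a : ℚ))|)) * ((a - n - 1).factorial : ℚ) := by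
              rw [abs_D2_neg n a ha1 ha2]; ring
        _ = K0 n * |Nnum n J (-(a : ℚ))| * ((a - n - 1).factorial : ℚ) := by
              rw [abs_D2_neg n a ha1 ha2, hcm]
        _ ≤ (n.factorial : ℚ) * |Nnum n J (-(a : ℚ))| * ((a - n).factorial : ℚ) := by
              apply mul_le_mul (mul_le_mul_of_nonneg_right hK hNnn) hfac (by positivity) (by positivity)
        _ = (n.factorial : ℚ) * (|Nnum n J (-(a : ℚ))| * ((a - n).factorial : ℚ)) := by ring
        _ ≤ (n.factorial : ℚ) * ((a + J).factorial : ℚ) := mul_le_mul_of_nonneg_left hN (by positivity)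
  -- Step 2: the factorial inequality
  have hkey : (n.factorial : ℚ) * (n.factorial : ℚ) * ((a + J).factorial : ℚ) * ((J + n).factorial : ℚ)
      ≤ (n : ℚ) * (((J + 2 * n).factorial : ℚ) * D) := by
    rw [hD]; exact_mod_cast key_coef_neg n J a hn ha1 ha2 hJ
  have hC := choose_mul_factorials J n
  have hX : (0 : ℚ) < D * ((n.factorial : ℚ) * ((J + n).factorial : ℚ)) := by positivity
  have h : |coef n J (-(a : ℚ))| * (D * ((n.factorial : ℚ) * ((J + n).factorial : ℚ)))
      ≤ (n : ℚ) * (((J + 2 * n).choose n : ℕ) : ℚ) * (D * ((n.factorial : ℚ) * ((J + n).factorial : ℚ))) := by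
    calc |coef n J (-(a : ℚ))| * (D * ((n.factorial : ℚ) * ((J + n).factorial : ℚ)))
        = (|coef n J (-(a : ℚ))| * D) * ((n.factorial : ℚ) * ((J + n).factorial : ℚ)) := by ring
      _ ≤ ((n.factorial : ℚ) * ((a + J).factorial : ℚ)) * ((n.factorial : ℚ) * ((J + n).factorial : ℚ)) :=
          mul_le_mul_of_nonneg_right hmain (by positivity)
      _ = (n.factorial : ℚ) * (n.factorial : ℚ) * ((a + J).factorial : ℚ) * ((J + n).factorial : ℚ) := by ring
      _ ≤ (n : ℚ) * (((J + 2 * n).factorial : ℚ) * D) := hkey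
      _ = (n : ℚ) * (((J + 2 * n).choose n : ℕ) : ℚ) * (D * ((n.factorial : ℚ) * ((J + n).factorial : ℚ))) := by
          rw [← hC]; ring
  exact le_of_mul_le_mul_right h hX

/-- **Poles `T = c ≥ 0`** (family α): `|coef n J c| ≤ n · C(J+2n, n)` for `c + n ≤ J`, `1 ≤ n`. -/
theorem abs_coef_nat_le (n J c : ℕ) (hn : 1 ≤ n) (hc : c + n ≤ J) :
    |coef n J (c : ℚ)| ≤ n * (((J + 2 * n).choose n : ℕ) : ℚ) := by
  obtain ⟨m, rfl⟩ : ∃ m, J = m + c := ⟨J - c, by omega⟩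
  have hmn : n ≤ m := by omega
  set D : ℚ := (((m - n).factorial * (c + 2 * n).factorial : ℕ) : ℚ) with hD
  have hDpos : 0 < D := by rw [hD]; positivity
  have hmain : |coef n (m + c) (c : ℚ)| * D ≤ (n.factorial : ℚ) * (m.factorial : ℚ) * (c.factorial : ℚ) := by
    have hcm := abs_coef_mul n (m + c) (c : ℚ)
    have hK := K0_le_factorial n
    have hN := abs_Nnum_alpha_le n m c
    have hD2 := abs_D2_alpha n c
    rw [abs_D1_alpha n m c hmn] at hcm
    have hpos : (0 : ℚ) < ((c + n).factorial : ℚ) := by positivity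
    have h : |coef n (m + c) (c : ℚ)| * D * ((c + n).factorial : ℚ)
        ≤ (n.factorial : ℚ) * (m.factorial : ℚ) * (c.factorial : ℚ) * ((c + n).factorial : ℚ) := by
      calc |coef n (m + c) (c : ℚ)| * D * ((c + n).factorial : ℚ)
          = (|coef n (m + c) (c : ℚ)| * ((((m - n).factorial * (c + n).factorial : ℕ) : ℚ) * |D2 n (c : ℚ)|))
              * (c.factorial : ℚ) := by rw [hD]; push_cast; rw [← hD2]; ring
        _ = K0 n * |Nnum n (m + c) (c : ℚ)| * (c.factorial : ℚ) := by rw [hcm]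
        _ ≤ (n.factorial : ℚ) * ((m.factorial : ℚ) * ((c + n).factorial : ℚ)) * (c.factorial : ℚ) := by
            apply mul_le_mul_of_nonneg_right _ (by positivity)
            exact mul_le_mul hK hN (abs_nonneg _) (by positivity)
        _ = (n.factorial : ℚ) * (m.factorial : ℚ) * (c.factorial : ℚ) * ((c + n).factorial : ℚ) := by ring
    exact le_of_mul_le_mul_right h hpos
  have hkey : (n.factorial : ℚ) * (n.factorial : ℚ) * (m.factorial : ℚ) * (c.factorial : ℚ)
      * ((m + c + n).factorial : ℚ) ≤ (n : ℚ) * (((m + c + 2 * n).factorial : ℚ) * D) := by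
    rw [hD]; exact_mod_cast key_coef_nat n m c hn hmn
  have hC := choose_mul_factorials (m + c) n
  have hX : (0 : ℚ) < D * ((n.factorial : ℚ) * ((m + c + n).factorial : ℚ)) := by positivity
  have h : |coef n (m + c) (c : ℚ)| * (D * ((n.factorial : ℚ) * ((m + c + n).factorial : ℚ)))
      ≤ (n : ℚ) * (((m + c + 2 * n).choose n : ℕ) : ℚ) * (D * ((n.factorial : ℚ) * ((m + c + n).factorial : ℚ))) := by
    calc |coef n (m + c) (c : ℚ)| * (D * ((n.factorial : ℚ) * ((m + c + n).factorial : ℚ)))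
        = (|coef n (m + c) (c : ℚ)| * D) * ((n.factorial : ℚ) * ((m + c + n).factorial : ℚ)) := by ring
      _ ≤ ((n.factorial : ℚ) * (m.factorial : ℚ) * (c.factorial : ℚ))
            * ((n.factorial : ℚ) * ((m + c + n).factorial : ℚ)) := mul_le_mul_of_nonneg_right hmain (by positivity)
      _ = (n.factorial : ℚ) * (n.factorial : ℚ) * (m.factorial : ℚ) * (c.factorial : ℚ)
            * ((m + c + n).factorial : ℚ) := by ring
      _ ≤ (n : ℚ) * (((m + c + 2 * n).factorial : ℚ) * D) := hkey
      _ = (n : ℚ) * (((m + c + 2 * n).choose n : ℕ) : ℚ)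
            * (D * ((n.factorial : ℚ) * ((m + c + n).factorial : ℚ))) := by rw [← hC]; ring
  exact le_of_mul_le_mul_right h hX

/-! ### The envelope of `PClosed` -/

/-- **Archimedean envelope of the explicit rational part**: `|PClosed n J| ≤ 48 (J+2n+1)³ · n · C(J+2n, n)`
for `1 ≤ n ≤ J`. -/
theorem abs_PClosed_le (n J : ℕ) (hn : 1 ≤ n) (hJ : n ≤ J) :
    |PClosed n J| ≤ 48 * ((J : ℚ) + 2 * n + 1) ^ 3 * (n * (((J + 2 * n).choose n : ℕ) : ℚ)) := by
  apply abs_PClosed_le_of_coef n J hn hJ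
  · intro c hc
    rw [Finset.mem_range] at hc
    exact abs_coef_nat_le n J c hn (by omega)
  · intro a ha
    rw [Finset.mem_Icc] at ha
    exact abs_coef_neg_le n J a hn ha.1 ha.2 hJ

/-- **On the ray `J = jn`** (`j ≥ 1`, `n ≥ 1`): `|rayPClosed j n| ≤ 48 ((j+2)n+1)³ · n · C((j+2)n, n)` — the envelope
of rate `b_{j+1} = (j+2) log (j+2) − (j+1) log (j+1)` feeding (T-G). -/
theorem abs_rayPClosed_le (j n : ℕ) (hj : 1 ≤ j) (hn : 1 ≤ n) :
    |rayPClosed j n| ≤ 48 * (((j + 2) * n : ℕ) + 1 : ℚ) ^ 3 * (n * ((((j + 2) * n).choose n : ℕ) : ℚ)) := by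
  have h := abs_PClosed_le n (j * n) hn (by nlinarith)
  rw [show j * n + 2 * n = (j + 2) * n by ring] at h
  have e : ((j * n : ℕ) : ℚ) + 2 * n + 1 = (((j + 2) * n : ℕ) : ℚ) + 1 := by push_cast; ring
  rw [e] at h
  exact h

end Summit.KontsevichZagierPeriods.Zeta5Search.Denom.CatalanRayPClosed
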